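import Summits.QuantumFields.YangMills.Theorems.AllWindowsColdBoxBoxHighLineRestrictionSetMoments
import Summits.QuantumFields.YangMills.Theorems.AllWindowsColdBoxBoxHighLineRestrictionCum3

/-!
# U5 ε₂-glue (G2c-2): the D-truncation transfer for `κ₃,₀` over `μ_{D′}` for a GENERAL measurable set `D′` (ASSEMBLY-U5 §3 cut small field)

Free-hands helper of the κ-lineage (ym-line-fcl-p3 g27) for Steps D–E of the NEXT rung U5 (`stub_landauThirdOrder`, LINE-20, ⟨stmt-QuantumFields-24336⟩).
Planner ym-idea-2 g18's `ASSEMBLY-U5.md` v0.1 §3: `f(t) := Cov_{μ_{D′},t}(c₀, c_T)` on the CUT small field `D′ = smallField s ∩ {|βV₃| ≤ 1}`, `f′(0) = −κ₃,₀(c₀, c_T; U)` «EXACTLY by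
Wick as CONNECTED 3-point sums (L2)» — under the FULL Gaussian `E₀`, i.e. after the D′-truncation transfer.  This is ✓`…RestrictionCum3` (G2b, `sfInd`/`smallField` letters)
re-lettered over ✓`…RestrictionSetMoments` for an ARBITRARY measurable `D` (indicator `D.indicator (fun _ => 1)`; `sfInd H s` is the instance `D = smallField H s` by `rfl`):

* ★★ `abs_tiltCum3_muSet_zero_sub_gaussCum3_le` — `E₀[1 − 1_D] ≤ τ ≤ 1/2`; `G₁, G₂, P` measurable, bounded by `B` on `D`, SIXTH moments under `E₀`; raw sizes
  `E₀[G₁²] ≤ A₁, …, E₀[(G₁G₂P)²] ≤ A₁₂₃`: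
  `|Tilt.tiltCum3 μ_D P 0 G₁ G₂ − (E₀[G₁G₂P] − E₀G₁·E₀[G₂P] − E₀G₂·E₀[G₁P] − E₀P·E₀[G₁G₂] + 2·(E₀G₁·E₀G₂·E₀P))|`
  `≤ √τ·(4√A₁₂₃ + 12(√A₃√A₁₂ + √A₂√A₁₃ + √A₁√A₂₃) + 56·(√A₁√A₂√A₃))` (E-side = LHS of w3 g41's ✓`gaussCum3_quadVal`, slots `A ↦ G₁, B ↦ G₂, M ↦ P`);
* `tiltCum3_muSet_zero_shift` (re-centring of all three letters over `μ_D`) and ★★ `abs_tiltCum3_muSet_zero_sub_gaussAvg_centred_le` (same bound against the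
  connected form `E₀[X̃ỸZ̃]`, sizes of the centred monomials).
Pure-real bookkeeping (`cum3_transfer_arith`) and the D-independent integrability toolbox are imported from G2a/G2b.

No definitions; standard axioms.  HONEST LABEL: helper-grade glue for U5 prep; U5, ⟨24004⟩, ⟨24336⟩ remain OPEN; route AllWindowsColdBox is DRAFT;
no crux, rung or summit is proved; the Yang–Mills mass gap is NOT proved by this file; no summit is proved by a line.
-/

set_option autoImplicit false

noncomputable section

open MeasureTheory Set

namespace Summit.QuantumFields.YangMills.Theorems.AllWindowsColdBoxBoxHighLine

namespace GaussRestrict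

variable {H : ℕ} {β : ℝ}

/-! ## The third-cumulant transfer `μ_D ↔ E₀` for a general measurable `D` -/

/-- ★★ **D-TRUNCATION TRANSFER FOR `κ₃,₀`.**  `E₀[1 − 1_D] ≤ τ ≤ 1/2`; `G₁, G₂, P` measurable, bounded by `B` on `D = D`, with sixth
moments under `E₀`; raw second-moment sizes `A_V ≥ E₀[V²]` for the seven monomials.  Then the third cumulant at `t = 0` over `μ_D` (any tilt letter,
here `P`) differs from the raw Gaussian third-cumulant expression (the LHS of ✓`gaussCum3_quadVal`, slots `G₁, G₂, P`) by
`≤ √τ·(4√A₁₂₃ + 12(√A₃√A₁₂ + √A₂√A₁₃ + √A₁√A₂₃) + 56·√A₁√A₂√A₃)`. -/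
theorem abs_tiltCum3_muSet_zero_sub_gaussCum3_le (hβ : 0 < β) {D : Set (LandauFree H → E3)} (hDm : MeasurableSet D) {τ : ℝ} (hτ : gaussAvg β H (fun a => 1 - D.indicator (fun _ => (1 : ℝ)) a) ≤ τ)
    (hτ2 : τ ≤ 1 / 2) {G₁ G₂ P : (LandauFree H → E3) → ℝ} (h₁ : Measurable G₁) (h₂ : Measurable G₂) (hP : Measurable P) {B : ℝ}
    (hB : 0 ≤ B) (h₁D : ∀ a ∈ D, |G₁ a| ≤ B) (h₂D : ∀ a ∈ D, |G₂ a| ≤ B)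
    (hPD : ∀ a ∈ D, |P a| ≤ B) (i₁ : Integrable (fun a => G₁ a ^ 6 * gaussWeight β H a))
    (i₂ : Integrable (fun a => G₂ a ^ 6 * gaussWeight β H a)) (iP : Integrable (fun a => P a ^ 6 * gaussWeight β H a))
    {A₁ A₂ A₃ A₁₂ A₁₃ A₂₃ A₁₂₃ : ℝ} (hA₁ : gaussAvg β H (fun a => G₁ a ^ 2) ≤ A₁) (hA₂ : gaussAvg β H (fun a => G₂ a ^ 2) ≤ A₂)
    (hA₃ : gaussAvg β H (fun a => P a ^ 2) ≤ A₃) (hA₁₂ : gaussAvg β H (fun a => (G₁ a * G₂ a) ^ 2) ≤ A₁₂)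
    (hA₁₃ : gaussAvg β H (fun a => (G₁ a * P a) ^ 2) ≤ A₁₃) (hA₂₃ : gaussAvg β H (fun a => (G₂ a * P a) ^ 2) ≤ A₂₃)
    (hA₁₂₃ : gaussAvg β H (fun a => (G₁ a * G₂ a * P a) ^ 2) ≤ A₁₂₃) :
    |Tilt.tiltCum3 (((volume : Measure (LandauFree H → E3)).restrict D).withDensity fun a => ENNReal.ofReal (gaussWeight β H a))
          P 0 G₁ G₂ -
        (gaussAvg β H (fun a => G₁ a * G₂ a * P a) - gaussAvg β H G₁ * gaussAvg β H (fun a => G₂ a * P a) -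
          gaussAvg β H G₂ * gaussAvg β H (fun a => G₁ a * P a) - gaussAvg β H P * gaussAvg β H (fun a => G₁ a * G₂ a) +
          2 * (gaussAvg β H G₁ * gaussAvg β H G₂ * gaussAvg β H P))| ≤
      Real.sqrt τ * (4 * Real.sqrt A₁₂₃ + 12 * (Real.sqrt A₃ * Real.sqrt A₁₂ + Real.sqrt A₂ * Real.sqrt A₁₃ + Real.sqrt A₁ * Real.sqrt A₂₃) +
        56 * (Real.sqrt A₁ * Real.sqrt A₂ * Real.sqrt A₃)) := by
  -- the D-mass and the instances
  have hD := integral_indicator_mul_gaussWeight_pos hβ hDm hτ hτ2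
  haveI := isFiniteMeasure_muSet hβ D
  haveI := neZero_muSet hβ hDm hD
  -- truncations: bounded measurable, a.e. equal to the originals
  have m₁' : Measurable fun a => D.indicator (fun _ => (1 : ℝ)) a * G₁ a := ((measurable_const.indicator hDm : Measurable (D.indicator (fun _ => (1 : ℝ))))).mul h₁
  have m₂' : Measurable fun a => D.indicator (fun _ => (1 : ℝ)) a * G₂ a := ((measurable_const.indicator hDm : Measurable (D.indicator (fun _ => (1 : ℝ))))).mul h₂
  have mP' : Measurable fun a => D.indicator (fun _ => (1 : ℝ)) a * P a := ((measurable_const.indicator hDm : Measurable (D.indicator (fun _ => (1 : ℝ))))).mul hP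
  have b₁' : ∀ a, |D.indicator (fun _ => (1 : ℝ)) a * G₁ a| ≤ B := fun a => abs_indicator_one_mul_le hB h₁D a
  have b₂' : ∀ a, |D.indicator (fun _ => (1 : ℝ)) a * G₂ a| ≤ B := fun a => abs_indicator_one_mul_le hB h₂D a
  have bP' : ∀ a, |D.indicator (fun _ => (1 : ℝ)) a * P a| ≤ B := fun a => abs_indicator_one_mul_le hB hPD a
  have hc := Tilt.tiltCum3_congr_ae (ae_muSet_eq_indicator_mul β hDm P) (ae_muSet_eq_indicator_mul β hDm G₁) (ae_muSet_eq_indicator_mul β hDm G₂) (0 : ℝ)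
  rw [hc, Tilt.tiltCum3_eq_raw mP' m₁' m₂' bP' b₁' b₂' 0]
  simp only [tiltExp_muSet_zero_eq hβ hDm]
  -- the products of truncations are the truncated products
  have e123 : (fun a => D.indicator (fun _ => (1 : ℝ)) a * (D.indicator (fun _ => (1 : ℝ)) a * G₁ a * (D.indicator (fun _ => (1 : ℝ)) a * G₂ a) * (D.indicator (fun _ => (1 : ℝ)) a * P a))) =
      fun a => D.indicator (fun _ => (1 : ℝ)) a * (G₁ a * G₂ a * P a) :=
    indicator_one_mul_congr_on fun a ha => by simp only [indicator_one_mul_eq_on _ ha]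
  have e12 : (fun a => D.indicator (fun _ => (1 : ℝ)) a * (D.indicator (fun _ => (1 : ℝ)) a * G₁ a * (D.indicator (fun _ => (1 : ℝ)) a * G₂ a))) = fun a => D.indicator (fun _ => (1 : ℝ)) a * (G₁ a * G₂ a) :=
    indicator_one_mul_congr_on fun a ha => by simp only [indicator_one_mul_eq_on _ ha]
  have e13 : (fun a => D.indicator (fun _ => (1 : ℝ)) a * (D.indicator (fun _ => (1 : ℝ)) a * G₁ a * (D.indicator (fun _ => (1 : ℝ)) a * P a))) = fun a => D.indicator (fun _ => (1 : ℝ)) a * (G₁ a * P a) :=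
    indicator_one_mul_congr_on fun a ha => by simp only [indicator_one_mul_eq_on _ ha]
  have e23 : (fun a => D.indicator (fun _ => (1 : ℝ)) a * (D.indicator (fun _ => (1 : ℝ)) a * G₂ a * (D.indicator (fun _ => (1 : ℝ)) a * P a))) = fun a => D.indicator (fun _ => (1 : ℝ)) a * (G₂ a * P a) :=
    indicator_one_mul_congr_on fun a ha => by simp only [indicator_one_mul_eq_on _ ha]
  have e1 : (fun a => D.indicator (fun _ => (1 : ℝ)) a * (D.indicator (fun _ => (1 : ℝ)) a * G₁ a)) = fun a => D.indicator (fun _ => (1 : ℝ)) a * G₁ a :=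
    indicator_one_mul_congr_on fun a ha => by simp only [indicator_one_mul_eq_on _ ha]
  have e2 : (fun a => D.indicator (fun _ => (1 : ℝ)) a * (D.indicator (fun _ => (1 : ℝ)) a * G₂ a)) = fun a => D.indicator (fun _ => (1 : ℝ)) a * G₂ a :=
    indicator_one_mul_congr_on fun a ha => by simp only [indicator_one_mul_eq_on _ ha]
  have e3 : (fun a => D.indicator (fun _ => (1 : ℝ)) a * (D.indicator (fun _ => (1 : ℝ)) a * P a)) = fun a => D.indicator (fun _ => (1 : ℝ)) a * P a :=
    indicator_one_mul_congr_on fun a ha => by simp only [indicator_one_mul_eq_on _ ha]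
  rw [e123, e12, e13, e23, e1, e2, e3]
  -- square-integrability of the seven monomials
  have q₁ := integrable_sq_mul_gaussWeight_of_six hβ h₁ i₁
  have q₂ := integrable_sq_mul_gaussWeight_of_six hβ h₂ i₂
  have q₃ := integrable_sq_mul_gaussWeight_of_six hβ hP iP
  have q₁₂ := integrable_sq_mul2_mul_gaussWeight hβ h₁ h₂ i₁ i₂
  have q₁₃ := integrable_sq_mul2_mul_gaussWeight hβ h₁ hP i₁ iP
  have q₂₃ := integrable_sq_mul2_mul_gaussWeight hβ h₂ hP i₂ iP
  have q₁₂₃ := integrable_sq_mul3_mul_gaussWeight hβ h₁ h₂ hP i₁ i₂ iP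
  -- the transfer of each monomial, and the sizes
  have d₁ := abs_rSet_sub_gaussAvg_le_of_sq_le hβ hDm hτ hτ2 h₁ q₁ hA₁
  have d₂ := abs_rSet_sub_gaussAvg_le_of_sq_le hβ hDm hτ hτ2 h₂ q₂ hA₂
  have d₃ := abs_rSet_sub_gaussAvg_le_of_sq_le hβ hDm hτ hτ2 hP q₃ hA₃
  have d₁₂ := abs_rSet_sub_gaussAvg_le_of_sq_le hβ hDm hτ hτ2 (h₁.mul h₂) q₁₂ hA₁₂
  have d₁₃ := abs_rSet_sub_gaussAvg_le_of_sq_le hβ hDm hτ hτ2 (h₁.mul hP) q₁₃ hA₁₃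
  have d₂₃ := abs_rSet_sub_gaussAvg_le_of_sq_le hβ hDm hτ hτ2 (h₂.mul hP) q₂₃ hA₂₃
  have d₁₂₃ := abs_rSet_sub_gaussAvg_le_of_sq_le hβ hDm hτ hτ2 ((h₁.mul h₂).mul hP) q₁₂₃ hA₁₂₃
  have b₂ := (abs_rSet_le hβ hDm hτ hτ2 h₂ q₂).trans (mul_le_mul_of_nonneg_left (Real.sqrt_le_sqrt hA₂) (by norm_num))
  have b₃ := (abs_rSet_le hβ hDm hτ hτ2 hP q₃).trans (mul_le_mul_of_nonneg_left (Real.sqrt_le_sqrt hA₃) (by norm_num))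
  have b₁₂ := (abs_rSet_le hβ hDm hτ hτ2 (h₁.mul h₂) q₁₂).trans (mul_le_mul_of_nonneg_left (Real.sqrt_le_sqrt hA₁₂) (by norm_num))
  have b₁₃ := (abs_rSet_le hβ hDm hτ hτ2 (h₁.mul hP) q₁₃).trans (mul_le_mul_of_nonneg_left (Real.sqrt_le_sqrt hA₁₃) (by norm_num))
  have b₂₃ := (abs_rSet_le hβ hDm hτ hτ2 (h₂.mul hP) q₂₃).trans (mul_le_mul_of_nonneg_left (Real.sqrt_le_sqrt hA₂₃) (by norm_num))
  have c₁ := (abs_gaussAvg_le_sqrt_sq hβ h₁ q₁).trans (Real.sqrt_le_sqrt hA₁)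
  have c₂ := (abs_gaussAvg_le_sqrt_sq hβ h₂ q₂).trans (Real.sqrt_le_sqrt hA₂)
  have c₃ := (abs_gaussAvg_le_sqrt_sq hβ hP q₃).trans (Real.sqrt_le_sqrt hA₃)
  exact cum3_transfer_arith d₁ d₂ d₃ d₁₂ d₁₃ d₂₃ d₁₂₃ b₂ b₃ b₁₂ b₁₃ b₂₃ c₁ c₂ c₃

/-! ## Re-centring at the full Gaussian means: the CENTRED form -/

/-- **Shift invariance of `κ₃,₀` over `μ_D`** for observables bounded on `D` (any constants; `0 < ∫ 1_D·gaussWeight`): both the two slots and the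
tilt letter may be re-centred (✓`Tilt.tiltCum3_shift`/`shiftU` on the `D`-truncations, transported by a.e.-congruence). -/
theorem tiltCum3_muSet_zero_shift (hβ : 0 < β) {D : Set (LandauFree H → E3)} (hDm : MeasurableSet D) (hD : 0 < ∫ a, D.indicator (fun _ => (1 : ℝ)) a * gaussWeight β H a)
    {G₁ G₂ P : (LandauFree H → E3) → ℝ} (h₁ : Measurable G₁) (h₂ : Measurable G₂) (hP : Measurable P) {B : ℝ} (hB : 0 ≤ B)
    (h₁D : ∀ a ∈ D, |G₁ a| ≤ B) (h₂D : ∀ a ∈ D, |G₂ a| ≤ B) (hPD : ∀ a ∈ D, |P a| ≤ B)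
    (c₁ c₂ c₃ : ℝ) :
    Tilt.tiltCum3 (((volume : Measure (LandauFree H → E3)).restrict D).withDensity fun a => ENNReal.ofReal (gaussWeight β H a))
        P 0 G₁ G₂ =
      Tilt.tiltCum3 (((volume : Measure (LandauFree H → E3)).restrict D).withDensity fun a => ENNReal.ofReal (gaussWeight β H a))
        (fun a => P a - c₃) 0 (fun a => G₁ a - c₁) (fun a => G₂ a - c₂) := by
  haveI := isFiniteMeasure_muSet hβ D
  haveI := neZero_muSet hβ hDm hD
  have m₁' : Measurable fun a => D.indicator (fun _ => (1 : ℝ)) a * G₁ a := ((measurable_const.indicator hDm : Measurable (D.indicator (fun _ => (1 : ℝ))))).mul h₁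
  have m₂' : Measurable fun a => D.indicator (fun _ => (1 : ℝ)) a * G₂ a := ((measurable_const.indicator hDm : Measurable (D.indicator (fun _ => (1 : ℝ))))).mul h₂
  have mP' : Measurable fun a => D.indicator (fun _ => (1 : ℝ)) a * P a := ((measurable_const.indicator hDm : Measurable (D.indicator (fun _ => (1 : ℝ))))).mul hP
  have b₁' : ∀ a, |D.indicator (fun _ => (1 : ℝ)) a * G₁ a| ≤ B := fun a => abs_indicator_one_mul_le hB h₁D a
  have b₂' : ∀ a, |D.indicator (fun _ => (1 : ℝ)) a * G₂ a| ≤ B := fun a => abs_indicator_one_mul_le hB h₂D a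
  have bP' : ∀ a, |D.indicator (fun _ => (1 : ℝ)) a * P a| ≤ B := fun a => abs_indicator_one_mul_le hB hPD a
  -- both sides through the truncations
  have hL := Tilt.tiltCum3_congr_ae (ae_muSet_eq_indicator_mul β hDm P) (ae_muSet_eq_indicator_mul β hDm G₁) (ae_muSet_eq_indicator_mul β hDm G₂) (0 : ℝ)
  have aP : (fun a => P a - c₃) =ᵐ[((volume : Measure (LandauFree H → E3)).restrict D).withDensity fun a =>
      ENNReal.ofReal (gaussWeight β H a)] fun a => D.indicator (fun _ => (1 : ℝ)) a * P a - c₃ := by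
    filter_upwards [ae_muSet_mem β hDm] with a ha
    rw [indicator_one_mul_eq_on P ha]
  have a₁ : (fun a => G₁ a - c₁) =ᵐ[((volume : Measure (LandauFree H → E3)).restrict D).withDensity fun a =>
      ENNReal.ofReal (gaussWeight β H a)] fun a => D.indicator (fun _ => (1 : ℝ)) a * G₁ a - c₁ := by
    filter_upwards [ae_muSet_mem β hDm] with a ha
    rw [indicator_one_mul_eq_on G₁ ha]
  have a₂ : (fun a => G₂ a - c₂) =ᵐ[((volume : Measure (LandauFree H → E3)).restrict D).withDensity fun a =>
      ENNReal.ofReal (gaussWeight β H a)] fun a => D.indicator (fun _ => (1 : ℝ)) a * G₂ a - c₂ := by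
    filter_upwards [ae_muSet_mem β hDm] with a ha
    rw [indicator_one_mul_eq_on G₂ ha]
  have hR := Tilt.tiltCum3_congr_ae aP a₁ a₂ (0 : ℝ)
  rw [hL, hR, Tilt.tiltCum3_shiftU mP' bP' c₃ 0, Tilt.tiltCum3_shift mP' m₁' m₂' bP' b₁' b₂' c₁ c₂ 0]

/-- ★★ **D-TRUNCATION TRANSFER FOR `κ₃,₀`, CENTRED FORM** (the shape of a connected three-point function: `E₀[X̃ỸZ̃]` with `X̃ = G₁ − E₀G₁`,
`Ỹ = G₂ − E₀G₂`, `Z̃ = P − E₀P`): under the hypotheses of ✓`abs_tiltCum3_muSet_zero_sub_gaussCum3_le` with the sizes now bounding the CENTRED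
monomials, `|Tilt.tiltCum3 μ_D P 0 G₁ G₂ − E₀[X̃ỸZ̃]| ≤ √τ·(4√A₁₂₃ + 12(√A₃√A₁₂ + √A₂√A₁₃ + √A₁√A₂₃) + 56·√A₁√A₂√A₃)`. -/
theorem abs_tiltCum3_muSet_zero_sub_gaussAvg_centred_le (hβ : 0 < β) {D : Set (LandauFree H → E3)} (hDm : MeasurableSet D) {τ : ℝ} (hτ : gaussAvg β H (fun a => 1 - D.indicator (fun _ => (1 : ℝ)) a) ≤ τ)
    (hτ2 : τ ≤ 1 / 2) {G₁ G₂ P : (LandauFree H → E3) → ℝ} (h₁ : Measurable G₁) (h₂ : Measurable G₂) (hP : Measurable P) {B : ℝ}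
    (hB : 0 ≤ B) (h₁D : ∀ a ∈ D, |G₁ a| ≤ B) (h₂D : ∀ a ∈ D, |G₂ a| ≤ B)
    (hPD : ∀ a ∈ D, |P a| ≤ B) (i₁ : Integrable (fun a => G₁ a ^ 6 * gaussWeight β H a))
    (i₂ : Integrable (fun a => G₂ a ^ 6 * gaussWeight β H a)) (iP : Integrable (fun a => P a ^ 6 * gaussWeight β H a))
    {A₁ A₂ A₃ A₁₂ A₁₃ A₂₃ A₁₂₃ : ℝ} (hA₁ : gaussAvg β H (fun a => (G₁ a - gaussAvg β H G₁) ^ 2) ≤ A₁)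
    (hA₂ : gaussAvg β H (fun a => (G₂ a - gaussAvg β H G₂) ^ 2) ≤ A₂) (hA₃ : gaussAvg β H (fun a => (P a - gaussAvg β H P) ^ 2) ≤ A₃)
    (hA₁₂ : gaussAvg β H (fun a => ((G₁ a - gaussAvg β H G₁) * (G₂ a - gaussAvg β H G₂)) ^ 2) ≤ A₁₂)
    (hA₁₃ : gaussAvg β H (fun a => ((G₁ a - gaussAvg β H G₁) * (P a - gaussAvg β H P)) ^ 2) ≤ A₁₃)
    (hA₂₃ : gaussAvg β H (fun a => ((G₂ a - gaussAvg β H G₂) * (P a - gaussAvg β H P)) ^ 2) ≤ A₂₃)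
    (hA₁₂₃ : gaussAvg β H (fun a => ((G₁ a - gaussAvg β H G₁) * (G₂ a - gaussAvg β H G₂) * (P a - gaussAvg β H P)) ^ 2) ≤ A₁₂₃) :
    |Tilt.tiltCum3 (((volume : Measure (LandauFree H → E3)).restrict D).withDensity fun a => ENNReal.ofReal (gaussWeight β H a))
          P 0 G₁ G₂ -
        gaussAvg β H (fun a => (G₁ a - gaussAvg β H G₁) * (G₂ a - gaussAvg β H G₂) * (P a - gaussAvg β H P))| ≤
      Real.sqrt τ * (4 * Real.sqrt A₁₂₃ + 12 * (Real.sqrt A₃ * Real.sqrt A₁₂ + Real.sqrt A₂ * Real.sqrt A₁₃ + Real.sqrt A₁ * Real.sqrt A₂₃) +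
        56 * (Real.sqrt A₁ * Real.sqrt A₂ * Real.sqrt A₃)) := by
  have hD := integral_indicator_mul_gaussWeight_pos hβ hDm hτ hτ2
  set m₁ := gaussAvg β H G₁ with hm₁
  set m₂ := gaussAvg β H G₂ with hm₂
  set b := gaussAvg β H P with hb
  rw [tiltCum3_muSet_zero_shift hβ hDm hD h₁ h₂ hP hB h₁D h₂D hPD m₁ m₂ b]
  -- the re-centred observables: measurable, bounded on `D`, sixth moments
  have hX : Measurable fun a => G₁ a - m₁ := h₁.sub measurable_const
  have hY : Measurable fun a => G₂ a - m₂ := h₂.sub measurable_const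
  have hZ : Measurable fun a => P a - b := hP.sub measurable_const
  have hB' : 0 ≤ B + (|m₁| + |m₂| + |b|) := by positivity
  have hXD : ∀ a ∈ D, |G₁ a - m₁| ≤ B + (|m₁| + |m₂| + |b|) := fun a ha =>
    (abs_sub _ _).trans (by linarith [h₁D a ha, abs_nonneg m₂, abs_nonneg b])
  have hYD : ∀ a ∈ D, |G₂ a - m₂| ≤ B + (|m₁| + |m₂| + |b|) := fun a ha =>
    (abs_sub _ _).trans (by linarith [h₂D a ha, abs_nonneg m₁, abs_nonneg b])
  have hZD : ∀ a ∈ D, |P a - b| ≤ B + (|m₁| + |m₂| + |b|) := fun a ha =>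
    (abs_sub _ _).trans (by linarith [hPD a ha, abs_nonneg m₁, abs_nonneg m₂])
  have iX := integrable_sub_const_pow_six_mul_gaussWeight hβ h₁ i₁ m₁
  have iY := integrable_sub_const_pow_six_mul_gaussWeight hβ h₂ i₂ m₂
  have iZ := integrable_sub_const_pow_six_mul_gaussWeight hβ hP iP b
  have key := abs_tiltCum3_muSet_zero_sub_gaussCum3_le hβ hDm hτ hτ2 hX hY hZ hB' hXD hYD hZD iX iY iZ hA₁ hA₂ hA₃ hA₁₂ hA₁₃ hA₂₃ hA₁₂₃
  -- the centred slots have zero mean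
  have z₁ : gaussAvg β H (fun a => G₁ a - m₁) = 0 := gaussAvg_sub_gaussAvg_eq_zero hβ h₁ (integrable_sq_mul_gaussWeight_of_six hβ h₁ i₁)
  have z₂ : gaussAvg β H (fun a => G₂ a - m₂) = 0 := gaussAvg_sub_gaussAvg_eq_zero hβ h₂ (integrable_sq_mul_gaussWeight_of_six hβ h₂ i₂)
  have z₃ : gaussAvg β H (fun a => P a - b) = 0 := gaussAvg_sub_gaussAvg_eq_zero hβ hP (integrable_sq_mul_gaussWeight_of_six hβ hP iP)
  simp only [z₁, z₂, z₃, zero_mul, mul_zero, sub_zero, add_zero] at key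
  exact key

end GaussRestrict

end Summit.QuantumFields.YangMills.Theorems.AllWindowsColdBoxBoxHighLine

end
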